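import Literature.Analysis.SpecialFunctions.LegendreRelation
import Literature.Analysis.SpecialFunctions.ZhouTripleEllipticIntegralProofs
import HarnessLib

/-!
# The derivative of the period ratio: `d/dk (K′/K) = −π/(2kk′²K²)`

Topic `Literature/Analysis/SpecialFunctions`. For `0 < k < 1` let `K = K(k)`, `K′ = K(k′)`,
`k′ = √(1 − k²)` (the tree's `completeEllipticK`, algebraic form). From Lawden's derivative formulae
(*Elliptic Functions and Applications* (1989), §3.8, PDF pp. 99–100)
(3.8.12) `dK/dk = (E − k′²K)/(kk′²)`, (3.8.14) `dK′/dk = (k²K′ − E′)/(kk′²)` and Legendre's relation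
(3.8.29) `EK′ + E′K − KK′ = π/2` one gets at once

  `d/dk (K′/K) = [K(k²K′ − E′) − K′(E − k′²K)]/(kk′²K²) = −(EK′ + E′K − KK′)/(kk′²K²) = −π/(2kk′²K²)`,

the formula that makes the nome `q = exp(−πK′/K)` a computable function of the modulus
(`dq/q = π²dk/(2kk′²K²)`; Lawden p. 99: "τ = iK′/K … exhibit τ (and therefore q) as a function of k").
Everything is PROVED from the tree: the `m = k²` derivative `hasDerivAt_Kt` and (3.8.12) in the form
`Ct_relation` of `LegendreRelation.lean`, and the discharged Legendre relation
`Lawden1989_eq_3_8_29_holds`. Main statements: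

* `hasDerivAt_Kt_ratio` — parameter form: for `0 < m < 1`,
  `d/dm [K(1−m)/K(m)] = −π/(4m(1−m)K(m)²)` (`K(m) = ∫₀^{π/2}(1 − m sin²θ)^{-1/2}dθ`);
* `hasDerivAt_completeEllipticK_ratio` — modulus form: for `0 < k < 1`,
  `d/dk [K(√(1−k²))/K(k)] = −π/(2k(1−k²)K(k)²)`;
* `strictAntiOn_completeEllipticK_ratio` — `k ↦ K′/K` is strictly decreasing on `(0,1)`;
* `image_completeEllipticK_ratio` — it maps `(0,1)` onto `(0,∞)`;
* `integral_Ioi_eq_integral_periodRatio` — the change of variables `σ = K′/K`: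
  `∫_{(0,∞)} G(σ) dσ = ∫_{(0,1)} π/(2k(1−k²)K²)·G(K′/K) dk` for every `G` (the substitution turning
  Mellin transforms in the nome `q = e^{−πσ}` into moments of elliptic integrals).

## References

* [Lawden1989] D. F. Lawden, *Elliptic Functions and Applications*, Springer (1989), §3.8
  eqs. (3.8.12), (3.8.14), (3.8.29) (PDF pp. 99–100); §2.2 eq. (2.2.3) (`q = exp(−πK′/K)`, p. 97).
* J. M. Borwein, P. B. Borwein, *Pi and the AGM*, Wiley (1987), §2.3 (the same computation).
-/

noncomputable section

open Real _root_.MeasureTheory _root_.Set _root_.Filter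
open scoped _root_.Topology

namespace Literature.Analysis.SpecialFunctions

open LegendreRelation

/-- **The derivative of the period ratio, parameter form.** For `0 < m < 1`, with
`K(m) = ∫₀^{π/2}(1 − m sin²θ)^{-1/2}dθ`,
`d/dm [K(1−m)/K(m)] = −π/(4m(1−m)K(m)²)` — from (3.8.8)/(3.8.12) (`hasDerivAt_Kt`, `Ct_relation`)
at `m` and `1 − m` and Legendre's relation (3.8.29). [cite: Lawden1989, §3.8 eqs. (3.8.12), (3.8.14), (3.8.29)] -/
theorem hasDerivAt_Kt_ratio {m : ℝ} (hm0 : 0 < m) (hm1 : m < 1) :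
    HasDerivAt (fun x => (∫ θ in (0:ℝ)..π / 2, 1 / √(1 - (1 - x) * sin θ ^ 2)) /
        ∫ θ in (0:ℝ)..π / 2, 1 / √(1 - x * sin θ ^ 2))
      (-π / (4 * m * (1 - m) * (∫ θ in (0:ℝ)..π / 2, 1 / √(1 - m * sin θ ^ 2)) ^ 2)) m := by
  set Kt : ℝ → ℝ := fun x => ∫ θ in (0:ℝ)..π / 2, 1 / √(1 - x * sin θ ^ 2) with hKt
  set Et : ℝ → ℝ := fun x => ∫ θ in (0:ℝ)..π / 2, √(1 - x * sin θ ^ 2) with hEt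
  set C : ℝ → ℝ := fun x => ∫ θ in (0:ℝ)..π / 2,
      sin θ ^ 2 / ((1 - x * sin θ ^ 2) * √(1 - x * sin θ ^ 2)) with hC
  have hm1' : 1 - m < 1 := by linarith
  -- `Kt m = K(√m) > 0`
  have hKpos : 0 < Kt m := by
    have h := completeEllipticK_eq_Kt (Real.sqrt m)
    rw [Real.sq_sqrt hm0.le] at h
    have hp : 0 < completeEllipticK (Real.sqrt m) :=
      completeEllipticK_pos (by rw [Real.sq_sqrt hm0.le]; exact hm1)
    simpa only [hKt, ← h] using hp
  -- the two derivatives (3.8.8) at `m` and, through `x ↦ 1 - x`, at `1 - m`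
  have hK : HasDerivAt Kt (1 / 2 * C m) m := hasDerivAt_Kt hm1
  have hsub : HasDerivAt (fun x : ℝ => 1 - x) (-1) m := by
    simpa using (hasDerivAt_id m).const_sub 1
  have hK' : HasDerivAt (fun x => Kt (1 - x)) (1 / 2 * C (1 - m) * -1) m :=
    (hasDerivAt_Kt hm1').comp m hsub
  have hdiv := hK'.div hK hKpos.ne'
  -- Legendre's relation and (3.8.12) at `m` and `1 - m`, in the `Kt/Et` vocabulary
  have hLeg : Et m * Kt (1 - m) + Et (1 - m) * Kt m - Kt m * Kt (1 - m) = π / 2 := by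
    have h := Lawden1989_eq_3_8_29_holds (Real.sqrt m) (Real.sqrt_pos.mpr hm0)
      ((Real.sqrt_lt' one_pos).mpr (by simpa using hm1))
    simp only [completeEllipticK_eq_Kt, completeEllipticE_eq_Et, Real.sq_sqrt hm0.le,
      Real.sq_sqrt (by linarith : (0:ℝ) ≤ 1 - m)] at h
    simpa only [hKt, hEt] using h
  have hC1 : m * (1 - m) * C m = Et m - (1 - m) * Kt m := Ct_relation hm1
  have hC2 : (1 - m) * (1 - (1 - m)) * C (1 - m) = Et (1 - m) - (1 - (1 - m)) * Kt (1 - m) :=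
    Ct_relation hm1'
  refine hdiv.congr_deriv ?_
  have h1m : 0 < 1 - m := by linarith
  have hK0 : Kt m ≠ 0 := hKpos.ne'
  have key : (1 / 2 * C (1 - m) * -1 * Kt m - Kt (1 - m) * (1 / 2 * C m)) * (4 * m * (1 - m)) = -π := by
    linear_combination (-2 * Kt m) * hC2 + (-2 * Kt (1 - m)) * hC1 - 2 * hLeg
  have hD : 4 * m * (1 - m) * Kt m ^ 2 ≠ 0 := by positivity
  rw [div_eq_div_iff (pow_ne_zero 2 hK0) hD]
  linear_combination (Kt m ^ 2) * key

/-- **The derivative of the period ratio `K′/K`** (modulus form): for `0 < k < 1`,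
`d/dk [K(√(1−k²))/K(k)] = −π/(2k(1−k²)K(k)²)`. [cite: Lawden1989, §3.8 eqs. (3.8.12), (3.8.14), (3.8.29)] -/
theorem hasDerivAt_completeEllipticK_ratio {k : ℝ} (hk : k ∈ Ioo (0 : ℝ) 1) :
    HasDerivAt (fun x => completeEllipticK (Real.sqrt (1 - x ^ 2)) / completeEllipticK x)
      (-π / (2 * k * (1 - k ^ 2) * completeEllipticK k ^ 2)) k := by
  have hm0 : 0 < k ^ 2 := by have := hk.1; positivity
  have hm1 : k ^ 2 < 1 := by nlinarith [hk.1, hk.2]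
  -- near `k` the function is `g (x²)` with `g m = Kt(1−m)/Kt(m)`
  have heq : (fun x => completeEllipticK (Real.sqrt (1 - x ^ 2)) / completeEllipticK x) =ᶠ[𝓝 k]
      fun x => (∫ θ in (0:ℝ)..π / 2, 1 / √(1 - (1 - x ^ 2) * sin θ ^ 2)) /
        ∫ θ in (0:ℝ)..π / 2, 1 / √(1 - x ^ 2 * sin θ ^ 2) := by
    filter_upwards [Ioo_mem_nhds hk.1 hk.2] with x hx
    have hx2 : 0 ≤ 1 - x ^ 2 := by nlinarith [hx.1, hx.2]
    rw [completeEllipticK_eq_Kt, completeEllipticK_eq_Kt, Real.sq_sqrt hx2]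
  set g : ℝ → ℝ := fun m => (∫ θ in (0:ℝ)..π / 2, 1 / √(1 - (1 - m) * sin θ ^ 2)) /
      ∫ θ in (0:ℝ)..π / 2, 1 / √(1 - m * sin θ ^ 2) with hgdef
  have hg : HasDerivAt g
      (-π / (4 * k ^ 2 * (1 - k ^ 2) * (∫ θ in (0:ℝ)..π / 2, 1 / √(1 - k ^ 2 * sin θ ^ 2)) ^ 2))
      ((fun x : ℝ => x ^ 2) k) := hasDerivAt_Kt_ratio hm0 hm1
  have hsq : HasDerivAt (fun x : ℝ => x ^ 2) (2 * k) k := (hasDerivAt_pow 2 k).congr_deriv (by norm_num)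
  have hcomp := HasDerivAt.comp (h₂ := g) (h := fun x : ℝ => x ^ 2) k hg hsq
  have heq' : (fun x => completeEllipticK (Real.sqrt (1 - x ^ 2)) / completeEllipticK x) =ᶠ[𝓝 k]
      (g ∘ fun x : ℝ => x ^ 2) := heq.trans (Eventually.of_forall fun x => rfl)
  refine (hcomp.congr_of_eventuallyEq heq').congr_deriv ?_
  rw [← completeEllipticK_eq_Kt k]
  have hk0 : k ≠ 0 := hk.1.ne'
  have hk1 : 1 - k ^ 2 ≠ 0 := by nlinarith [hk.1, hk.2]
  have hK0 : completeEllipticK k ≠ 0 := (completeEllipticK_pos hm1).ne'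
  field_simp
  ring

/-- **`K′/K` is strictly decreasing on `(0,1)`** (`K` strictly increases, `K′` strictly decreases,
both positive). [folklore] -/
theorem strictAntiOn_completeEllipticK_ratio :
    StrictAntiOn (fun k => completeEllipticK (Real.sqrt (1 - k ^ 2)) / completeEllipticK k)
      (Ioo (0 : ℝ) 1) := by
  intro a ha b hb hab
  have ha2 : a ^ 2 < 1 := by nlinarith [ha.1, ha.2]
  have hb2 : b ^ 2 < 1 := by nlinarith [hb.1, hb.2]
  have hKa : 0 < completeEllipticK a := completeEllipticK_pos ha2
  have hKb : 0 < completeEllipticK b := completeEllipticK_pos hb2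
  have hK'b : 0 < completeEllipticK (Real.sqrt (1 - b ^ 2)) := by
    rw [completeEllipticK_compl_eq_ellipticK hb2.le]
    exact Literature.Probability.RandomPlanarGeometry.ellipticK_pos (by nlinarith [hb.1]) (by nlinarith [hb.1])
  -- `K(a) < K(b)` and `K′(b) < K′(a)`
  have h1 : completeEllipticK a < completeEllipticK b := by
    rw [completeEllipticK_eq_ellipticK, completeEllipticK_eq_ellipticK]
    exact Literature.Probability.RandomPlanarGeometry.ellipticK_strictMonoOn ha2 hb2 (by nlinarith [ha.1, hb.1])
  have h2 : completeEllipticK (Real.sqrt (1 - b ^ 2)) < completeEllipticK (Real.sqrt (1 - a ^ 2)) := by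
    rw [completeEllipticK_compl_eq_ellipticK hb2.le, completeEllipticK_compl_eq_ellipticK ha2.le]
    exact Literature.Probability.RandomPlanarGeometry.ellipticK_strictMonoOn
      (show 1 - b ^ 2 < 1 by nlinarith [hb.1]) (show 1 - a ^ 2 < 1 by nlinarith [ha.1]) (by nlinarith [ha.1, hb.1])
  show completeEllipticK (Real.sqrt (1 - b ^ 2)) / completeEllipticK b <
    completeEllipticK (Real.sqrt (1 - a ^ 2)) / completeEllipticK a
  calc completeEllipticK (Real.sqrt (1 - b ^ 2)) / completeEllipticK b
        < completeEllipticK (Real.sqrt (1 - a ^ 2)) / completeEllipticK b := div_lt_div_of_pos_right h2 hKb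
    _ ≤ completeEllipticK (Real.sqrt (1 - a ^ 2)) / completeEllipticK a :=
        div_le_div_of_nonneg_left (hK'b.trans h2).le hKa h1.le

/-- **The period ratio maps `(0,1)` onto `(0,∞)`**: every `c > 0` is `K′(k)/K(k)` for a (unique)
`0 < k < 1` (the tree's `exists_ellipticK_compl_eq_mul`), and the ratio is positive. [folklore] -/
theorem image_completeEllipticK_ratio :
    (fun k => completeEllipticK (Real.sqrt (1 - k ^ 2)) / completeEllipticK k) '' Ioo (0 : ℝ) 1 = Ioi 0 := by
  ext c
  constructor
  · rintro ⟨k, hk, rfl⟩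
    have hk2 : k ^ 2 < 1 := by nlinarith [hk.1, hk.2]
    have hK : 0 < completeEllipticK k := completeEllipticK_pos hk2
    have hK' : 0 < completeEllipticK (Real.sqrt (1 - k ^ 2)) := by
      rw [completeEllipticK_compl_eq_ellipticK hk2.le]
      exact Literature.Probability.RandomPlanarGeometry.ellipticK_pos (by nlinarith [hk.1]) (by nlinarith [hk.1])
    exact div_pos hK' hK
  · intro hc
    obtain ⟨k, hk0, hk1, hk⟩ := Literature.Probability.RandomPlanarGeometry.exists_ellipticK_compl_eq_mul
      (show (0:ℝ) < c from hc)
    have hk2 : k ^ 2 < 1 := by nlinarith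
    have hK : 0 < completeEllipticK k := completeEllipticK_pos hk2
    refine ⟨k, ⟨hk0, hk1⟩, ?_⟩
    show completeEllipticK (Real.sqrt (1 - k ^ 2)) / completeEllipticK k = c
    rw [div_eq_iff hK.ne', completeEllipticK_compl_eq_ellipticK hk2.le, hk, completeEllipticK_eq_ellipticK]

/-- **Integration against the period ratio** (change of variables `σ = K′(k)/K(k)`, a decreasing
diffeomorphism of `(0,1)` onto `(0,∞)` with `|dσ/dk| = π/(2k(1−k²)K(k)²)`): for every `G`,
`∫_{(0,∞)} G(σ) dσ = ∫_{(0,1)} π/(2k(1−k²)K(k)²) · G(K′(k)/K(k)) dk` (both sides Bochner integrals, no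
integrability hypothesis). This is the substitution that turns Mellin transforms in the nome
`q = e^{−πσ}` into moments of elliptic integrals. [cite: Lawden1989, §3.8 eqs. (3.8.12), (3.8.14), (3.8.29); §2.2 eq. (2.2.3)] -/
theorem integral_Ioi_eq_integral_periodRatio (G : ℝ → ℝ) :
    ∫ σ in Ioi (0 : ℝ), G σ =
      ∫ k in Ioo (0 : ℝ) 1, π / (2 * k * (1 - k ^ 2) * completeEllipticK k ^ 2) *
        G (completeEllipticK (Real.sqrt (1 - k ^ 2)) / completeEllipticK k) := by
  have hderiv : ∀ k ∈ Ioo (0 : ℝ) 1,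
      HasDerivWithinAt (fun x => completeEllipticK (Real.sqrt (1 - x ^ 2)) / completeEllipticK x)
        (-π / (2 * k * (1 - k ^ 2) * completeEllipticK k ^ 2)) (Ioo 0 1) k :=
    fun k hk => (hasDerivAt_completeEllipticK_ratio hk).hasDerivWithinAt
  have key := integral_image_eq_integral_abs_deriv_smul measurableSet_Ioo hderiv
    strictAntiOn_completeEllipticK_ratio.injOn G
  rw [image_completeEllipticK_ratio] at key
  rw [key]
  refine setIntegral_congr_fun measurableSet_Ioo (fun k hk => ?_)
  have hk2 : k ^ 2 < 1 := by nlinarith [hk.1, hk.2]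
  have hK : 0 < completeEllipticK k := completeEllipticK_pos hk2
  have hpos : 0 < π / (2 * k * (1 - k ^ 2) * completeEllipticK k ^ 2) := by
    have h1 : 0 < 1 - k ^ 2 := by nlinarith
    have := hk.1
    positivity
  rw [smul_eq_mul, neg_div, abs_neg, abs_of_pos hpos]

end Literature.Analysis.SpecialFunctions

end
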